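import Summits.QuantumFields.YangMills.Theorems.F4SubCurvatureDoorShortRootRigidityTwoMirrorLFConstancy
import Summits.QuantumFields.YangMills.Theorems.F4SubCurvatureDoorPlanarLaplaceFourier
import Mathlib
import HarnessLib

/-!
# Transverse slice — the by-name rung `BoundedPlanarConstancy` (LINE g19-A, ⟨stmt-QuantumFields-23035⟩): the BOUNDED sub-claim of the heart

LINE g19-A «transverse slice» on crux ⟨stmt-QuantumFields-23035⟩ `F4SubCurvatureDoor.ShortRootRigidity`; rung file
`Cruxes/ShortRootRigidity/Lines/transverse_slice_rung_bounded.lean` (ns `…Cruxes.ShortRootRigidity.TransverseSlice.BoundedRung`).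
This file restates the rung `BoundedPlanarConstancy` and its certified glue `planarRigidity_of_bounded` CHARACTER-IDENTICALLY
(`E2` is the tree's `…SliceDensityRegistered.E2`, `hexReflection`/`InPlanarClass` are the tree's `…SliceInClassRegistered` copies of
the skeleton's, `rot`/`lf`/`HexagonalLFConstancy` are the by-name copies of `…TwoMirrorLFConstancyRegistered`) and PROVES

* `boundedPlanarConstancy : BoundedPlanarConstancy` — a planar-class kernel that is bounded off the origin is constant off the origin;
* hence (`planarRigidity_of_bounded`, the rung file's glue) the skeleton's `PlanarRigidity` conclusion for kernels bounded off `0`.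

PROOF.  (1) Berg–Christensen–Ressel via the tree: `k(t, x) := k(mk t x)` is positive definite on the `*`-semigroup `(0,∞) × ℝ`
(the planar RP conjunct of `InPlanarClass` + time-reflection invariance), even in `x` (evenness + time reflection), continuous in `x`
for `t > 0` (continuity off `0`) and bounded, so `Literature.Analysis.FunctionSpaces.exists_laplaceFourierMeasure` gives a positive
measure `μ` on `ℝ × ℝ` carried by `E ≥ 0` with `k(mk t x) = ∫ e^{-tE} cos(px) dμ` for `t > 0`; boundedness of `k` NEAR `0` makes `μ`
FINITE (Fatou as `t → 0⁺`), and continuity of `k` off `0` plus dominated convergence extend the representation to `t = 0`, `x ≠ 0`: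
`k = lf μ` off the origin.  (2) `rot(π/3) = -(θ₂ ∘ σ_{n'})`, so the `D₆`-invariance conjuncts of `InPlanarClass` make `lf μ`
invariant under the rotation by `π/3`.  (3) `…TwoMirrorLFConstancyRegistered.hexagonalLFConstancy` (R1): `lf μ` is constant.

HONEST LABEL: the BOUNDED toy case of the heart `stub_planarRigidity` of an OPEN line (where the budget conjunct is vacuous); nothing
about the singular case of `PlanarRigidity`, C3, ⟨23035⟩, ⟨23125⟩, R2d or any summit is proved by this file; the Yang–Mills mass gap
is NOT proved; no summit is proved by a line.
-/

noncomputable section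

open MeasureTheory Filter Topology Set
open scoped BigOperators

namespace Summit.QuantumFields.YangMills.Theorems.F4SubCurvatureDoorBoundedPlanarConstancyRegistered

open Literature.MathematicalPhysics.QuantumLattice (timeReflection timeReflection_apply)
open Summit.QuantumFields.YangMills.Theorems.F4SubCurvatureDoorSliceDensityRegistered (E2)
open Summit.QuantumFields.YangMills.Theorems.F4SubCurvatureDoorSliceInClassRegistered (hexReflection InPlanarClass)
open Summit.QuantumFields.YangMills.Theorems.F4SubCurvatureDoorTwoMirrorLFConstancyRegistered
  (rot lf HexagonalLFConstancy hexagonalLFConstancy)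
open Summit.QuantumFields.YangMills.Theorems.F4SubCurvatureDoorPlanarLaplaceFourier

/-- RUNG «BOUNDED PLANAR CONSTANCY»: a planar-class kernel that is bounded off the origin is constant off the origin. -/
def BoundedPlanarConstancy : Prop :=
  ∀ k : E2 → ℝ, InPlanarClass k → (∃ C : ℝ, ∀ y : E2, y ≠ 0 → |k y| ≤ C) → ∃ c : ℝ, ∀ y : E2, y ≠ 0 → k y = c

/-- Certified glue: the rung gives `PlanarRigidity` (the skeleton's conclusion, verbatim shape) for kernels bounded off `0`. -/
theorem planarRigidity_of_bounded (h : BoundedPlanarConstancy) :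
    ∀ k : E2 → ℝ, InPlanarClass k → (∃ C : ℝ, ∀ y : E2, y ≠ 0 → |k y| ≤ C) →
      ∀ (R : E2 ≃ₗᵢ[ℝ] E2) (y : E2), y ≠ 0 → k (R y) = k y := by
  intro k hk hb R y hy
  obtain ⟨c, hc⟩ := h k hk hb
  have hRy : R y ≠ 0 := fun h0 => hy (by simpa using congrArg R.symm h0)
  rw [hc (R y) hRy, hc y hy]

/-! ## The rung -/

/-- **RUNG R2 (by name): `BoundedPlanarConstancy`.** -/
theorem boundedPlanarConstancy : BoundedPlanarConstancy := by
  intro k hk hb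
  -- (1) the Laplace–Fourier measure (Berg–Christensen–Ressel via the tree)
  obtain ⟨μ, hμsupp, hμ⟩ := exists_planarLF k hk
  obtain ⟨hcont, -, hθ, hhex, hneg, -, -⟩ := hk
  obtain ⟨C, hC⟩ := hb
  -- plane points
  set mk : ℝ → ℝ → E2 := fun t x => (WithLp.equiv 2 (Fin 2 → ℝ)).symm ![t, x] with hmk_def
  have hmk0 : ∀ t x, mk t x 0 = t := fun t x => mk_apply_zero t x
  have hmk1 : ∀ t x, mk t x 1 = x := fun t x => mk_apply_one t x
  have hθmk : ∀ t x, timeReflection 2 (mk t x) = mk (-t) x := fun t x => timeReflection_mk t x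
  have hmk_ne : ∀ t x, t ≠ 0 → mk t x ≠ 0 := fun t x ht => mk_ne_zero_left x ht
  have hrepr : ∀ t, 0 < t → ∀ x, k (mk t x) = ∫ z, Real.exp (-(z.1 * t)) * Real.cos (z.2 * x) ∂μ :=
    fun t ht x => (hμ t ht).2 x
  -- μ is finite: `∫ e^{-tE} dμ = k(t, 0) ≤ C`, Fatou as `t → 0⁺`
  have hlap : ∀ t, 0 < t → ∫⁻ z, ENNReal.ofReal (Real.exp (-(t * z.1))) ∂μ ≤ ENNReal.ofReal C := by
    intro t ht
    rw [← ofReal_integral_eq_lintegral_ofReal (hμ t ht).1 (ae_of_all _ fun z => (Real.exp_pos _).le)]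
    apply ENNReal.ofReal_le_ofReal
    have h := (hμ t ht).2 0
    simp only [mul_zero, Real.cos_zero, mul_one] at h
    have h' : ∫ z, Real.exp (-(t * z.1)) ∂μ = k (mk t 0) := by
      rw [h]
      refine integral_congr_ae (ae_of_all _ fun z => ?_)
      simp only [mul_comm]
    rw [h']
    exact le_trans (le_abs_self _) (hC _ (hmk_ne t 0 ht.ne'))
  have huniv : μ univ ≤ ENNReal.ofReal C := by
    have hF := lintegral_liminf_le (μ := μ) (u := 𝓝[>] (0 : ℝ))
      (f := fun t z => ENNReal.ofReal (Real.exp (-(t * z.1)))) (fun t => by fun_prop)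
    have hlim : ∀ z : ℝ × ℝ, liminf (fun t => ENNReal.ofReal (Real.exp (-(t * z.1)))) (𝓝[>] (0 : ℝ)) = 1 := by
      intro z
      refine Tendsto.liminf_eq ?_
      have : Tendsto (fun t : ℝ => ENNReal.ofReal (Real.exp (-(t * z.1)))) (𝓝 0) (𝓝 (ENNReal.ofReal (Real.exp (-(0 * z.1))))) :=
        ((ENNReal.continuous_ofReal.comp (Real.continuous_exp.comp (by fun_prop))).tendsto 0)
      simp only [zero_mul, neg_zero, Real.exp_zero, ENNReal.ofReal_one] at this
      exact tendsto_nhdsWithin_of_tendsto_nhds this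
    simp_rw [hlim, lintegral_one] at hF
    refine hF.trans ?_
    refine Filter.liminf_le_of_frequently_le' (Filter.Eventually.frequently ?_)
    exact eventually_nhdsWithin_of_forall fun t ht => hlap t ht
  haveI hfin : IsFiniteMeasure μ := ⟨lt_of_le_of_lt huniv ENNReal.ofReal_lt_top⟩
  have hsupp : μ {z : ℝ × ℝ | z.1 < 0} = 0 := by
    have e : {z : ℝ × ℝ | z.1 < 0} = Iio 0 ×ˢ univ := by
      ext z; simp
    rw [e]; exact hμsupp
  -- `k = lf μ` off the origin
  have hlf : ∀ y : E2, y ≠ 0 → k y = lf μ y := by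
    intro y hy
    by_cases hy0 : y 0 = 0
    · -- `y₀ = 0`: limit `t → 0⁺` on both sides
      have hy1 : y 1 ≠ 0 := by
        intro h1
        apply hy
        refine ext2 ?_ ?_
        · rw [hy0]; rfl
        · rw [h1]; rfl
      -- left: continuity of `k` at `y`
      have hL : Tendsto (fun t : ℝ => k (mk t (y 1))) (𝓝[>] 0) (𝓝 (k y)) := by
        have hya : mk 0 (y 1) = y := by
          refine ext2 ?_ ?_
          · rw [hmk0, hy0]
          · rw [hmk1]
        have hka : ContinuousAt k y := hcont.continuousAt (isOpen_ne.mem_nhds hy)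
        have h1 : Tendsto (fun t : ℝ => mk t (y 1)) (𝓝 0) (𝓝 y) := by
          rw [← hya]
          exact (continuous_mk_left (y 1)).tendsto 0
        exact tendsto_nhdsWithin_of_tendsto_nhds (hka.tendsto.comp h1)
      -- right: dominated convergence
      have hR : Tendsto (fun t : ℝ => ∫ z, Real.exp (-(z.1 * t)) * Real.cos (z.2 * y 1) ∂μ) (𝓝[>] 0)
          (𝓝 (∫ z, Real.cos (z.2 * y 1) ∂μ)) := by
        have hae : ∀ᵐ z ∂μ, 0 ≤ z.1 := by
          rw [ae_iff]; simpa [not_le] using hsupp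
        refine tendsto_integral_filter_of_dominated_convergence (fun _ => 1) ?_ ?_ (integrable_const 1) ?_
        · exact Eventually.of_forall fun t => by fun_prop
        · refine eventually_nhdsWithin_of_forall fun t (ht : 0 < t) => ?_
          filter_upwards [hae] with z hz
          rw [Real.norm_eq_abs, abs_mul]
          refine mul_le_one₀ ?_ (abs_nonneg _) (Real.abs_cos_le_one _)
          rw [Real.abs_exp, Real.exp_le_one_iff]
          nlinarith
        · refine Eventually.of_forall fun z => ?_
          have : Tendsto (fun t : ℝ => Real.exp (-(z.1 * t)) * Real.cos (z.2 * y 1)) (𝓝 0)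
              (𝓝 (Real.exp (-(z.1 * 0)) * Real.cos (z.2 * y 1))) :=
            ((Real.continuous_exp.comp (by fun_prop)).mul continuous_const).tendsto 0
          simp only [mul_zero, neg_zero, Real.exp_zero, one_mul] at this
          exact tendsto_nhdsWithin_of_tendsto_nhds this
      have hLR : (fun t : ℝ => k (mk t (y 1))) =ᶠ[𝓝[>] 0]
          fun t : ℝ => ∫ z, Real.exp (-(z.1 * t)) * Real.cos (z.2 * y 1) ∂μ :=
        eventually_nhdsWithin_of_forall fun t (ht : 0 < t) => hrepr t ht (y 1)
      have hlim := tendsto_nhds_unique (hL.congr' hLR) hR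
      rw [hlim, lf, hy0]
      refine integral_congr_ae (ae_of_all _ fun z => ?_)
      simp
    · -- `y₀ ≠ 0`: the representation at `t = |y₀|`
      have ht : 0 < |y 0| := abs_pos.2 hy0
      rw [lf, ← hrepr _ ht]
      rcases lt_or_gt_of_ne hy0 with hneg' | hpos'
      · rw [abs_of_neg hneg', ← hθmk, hθ]
        congr 1
        exact (mk_eta y).symm
      · rw [abs_of_pos hpos']
        congr 1
        exact (mk_eta y).symm
  -- (2) `rot(π/3) = -(θ₂ ∘ σ_{n'})`, so `lf μ` is invariant under the rotation by `π/3`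
  have hrot : ∀ y : E2, rot (Real.pi / 3) y = -(timeReflection 2 (hexReflection y)) := by
    intro y
    refine ext2 ?_ ?_
    · simp [rot, hexReflection, timeReflection_apply, Real.cos_pi_div_three, Real.sin_pi_div_three]
      ring
    · simp [rot, hexReflection, timeReflection_apply, Real.cos_pi_div_three, Real.sin_pi_div_three]
      ring
  have hrot_ne : ∀ y : E2, y ≠ 0 → rot (Real.pi / 3) y ≠ 0 := by
    intro y hy h
    rw [hrot, neg_eq_zero] at h
    apply hy
    have h' := congrArg (timeReflection 2) h
    rw [Literature.MathematicalPhysics.QuantumLattice.timeReflection_timeReflection, map_zero] at h'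
    -- `hexReflection` is an involution
    have hinv : hexReflection (hexReflection y) = y := by
      refine ext2 ?_ ?_
      · simp [hexReflection]
        ring_nf
        have h3 : Real.sqrt 3 ^ 2 = 3 := Real.sq_sqrt (by norm_num)
        rw [h3]; ring
      · simp [hexReflection]
        ring_nf
        have h3 : Real.sqrt 3 ^ 2 = 3 := Real.sq_sqrt (by norm_num)
        rw [h3]; ring
    rw [← hinv, h']
    refine ext2 ?_ ?_ <;> simp [hexReflection]
  have hinvrot : ∀ y : E2, lf μ (rot (Real.pi / 3) y) = lf μ y := by
    intro y
    by_cases hy : y = 0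
    · subst hy
      have : rot (Real.pi / 3) (0 : E2) = 0 := by
        refine ext2 ?_ ?_ <;> simp [rot]
      rw [this]
    · rw [← hlf y hy, ← hlf _ (hrot_ne y hy), hrot, hneg, hθ, hhex]
  -- (3) the engine R1
  have hconst := hexagonalLFConstancy μ hfin hsupp hinvrot
  exact ⟨lf μ 0, fun y hy => by rw [hlf y hy, hconst y]⟩

end Summit.QuantumFields.YangMills.Theorems.F4SubCurvatureDoorBoundedPlanarConstancyRegistered

end
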